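import Summits.Parity.GeneralizedHardyLittlewood.Theorems.GoldbachHeathBrownDispersionHeathBrownMorozUniformClassMainError
import Summits.Parity.GeneralizedHardyLittlewood.Theorems.GoldbachHeathBrownDispersionHeathBrownMorozUniformClassMainCauchy
import Summits.Parity.GeneralizedHardyLittlewood.Theorems.GoldbachHeathBrownDispersionHeathBrownMorozUniformTwistedSsum
import Summits.Parity.GeneralizedHardyLittlewood.Theorems.GoldbachHeathBrownDispersionHeathBrownMorozUniformOfTwoClassLemmas
import Literature.NumberTheory.Sieve.HeathBrownCubicTypeIIFinal
import HarnessLib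

/-!
# Crux `HeathBrownMorozUniform` (stmt-Parity-19915): class `S_V` bound and the class p. 83 bound (Type II, part 1)

Heath-Brown, Acta Math. 186 (2001), Lemma 3.10 (Lemma 12.2 + §13 p. 83 + (13.7)) for the class family
`classPairs X η d a b` of Heath-Brown–Moroz 2004, Prop. 4.2 (ii), with hypothesis (3.14) up to `d·Q₁`:
the proved glue of the merged skeleton `Cruxes/HeathBrownMorozUniform/Lines/unit_split_positivity.lean`
(Part B: `classSV_le_of_params`, `class_p83`, `class_310`, `h310_of`) instantiated at the three LANDED
Type II stubs `stub_classMainError` (E3), `stub_classMainCauchy` (E4), `stub_twistedSsum` (E5) — copied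
letter for letter with the stub hypotheses replaced by the theorems. Result: `class_h310`, literally the
hypothesis `h310` of `heathBrownMorozUniform_of_classLemmas` / `…_of_twoClassLemmas`; hence
`heathBrownMorozUniform_of_h39 : h39 → HeathBrownMorozUniform` — the crux now rests on the class leading
parts `h39` alone (line stubs S3 `stub_sigmaOneCoprime` + S4b `stub_classDisplay104`). Goldbach is not proved by this.

## References

* D. R. Heath-Brown, Acta Math. 186 (2001), Lemma 3.10, Lemma 12.2, §13 p. 83. [cite: HeathBrownActa2001, Lemma 3.10]
* D. R. Heath-Brown, B. Z. Moroz, Proc. London Math. Soc. 88 (2004), Prop. 4.2 (ii). [cite: HeathBrownMoroz2004, Proposition 4.2]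
-/

noncomputable section

open Polynomial NumberField Finset Filter Topology Asymptotics

namespace Summit.Parity.GeneralizedHardyLittlewood.Theorems.GoldbachHeathBrownDispersionHeathBrownMorozUniform

open Literature.NumberTheory.Sieve.CubicSieve Literature.NumberTheory.Sieve.CubicPrimes
open Literature.NumberTheory.LFunctions.CubeRootTwoField


/-! ### Proved glue: from the three Type II stubs to the class Lemma 3.10 -/

/-- `D ∣ u` componentwise ⇒ (`D ∣ b + u − v` componentwise iff `D ∣ b − v` componentwise). [cite: HeathBrownActa2001, Lemma 12.2] -/
theorem dvdVec_add_sub_iff {D : ℤ} {b u v : ℤ × ℤ × ℤ} (hu : DvdVec D u) :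
    DvdVec D (b + u - v) ↔ DvdVec D (b - v) := by
  obtain ⟨h1, h2, h3⟩ := hu
  have key : ∀ {x y z : ℤ}, D ∣ y → (D ∣ x + y - z ↔ D ∣ x - z) := by
    intro x y z hy
    rw [show x + y - z = (x - z) + y by ring]
    exact dvd_add_left hy
  simp only [DvdVec, Prod.fst_add, Prod.snd_add, Prod.fst_sub, Prod.snd_sub]
  rw [key h1, key h2, key h3]

set_option maxHeartbeats 1600000 in
open scoped Classical in
/-- **Class `SV_le_of_params`** (Lemma 12.2 with §13 for the class family): under the parameter
inequalities of the tree's `SV_le_of_params`, with (3.14) up to `d·Q₁`,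
`|S_V^{cl}| ≤ K·X²·(Y^{−1/2} + Y³⁰X^{−τ/4} + Y⁸Q₁^{−1/8} + Y⁸Q₁²e^{−(c₁/2)√(log L)})(log X)^{c₀}`,
`K = K(d, κ, C₁, c₅)` — from stubs 3, 4, 5 (main + error, residue split + Cauchy, twisted `S`), the
arithmetic being that of the tree's `SV_le_of_params`. [cite: HeathBrownActa2001, Lemma 12.2, §13 p. 83] -/
theorem classSV_le_of_params :
    ∃ c₀ : ℝ, 0 ≤ c₀ ∧ ∀ (κ C₁ c₅ : ℝ) (d : ℕ), 0 < κ → 0 < c₅ → 0 < d → ∃ Kc : ℝ, 0 < Kc ∧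
      ∀ (X η τ V T Y Q₁ c₁ W : ℝ) (nn : ℕ) (m : Fin (nn + 1) → ℕ) (cR : Ideal (𝓞 K) → ℝ) (a₀ b₀ : ℕ),
        0 ≤ η → η ≤ 1 → 0 < τ → τ ≤ 1 → CoreAdmissible τ m → Hyp314 X τ m ((d : ℝ) * Q₁) C₁ c₁ 3 1 →
        CSupport X τ cR →
        2 ≤ X → 1 ≤ Real.log X → 1 ≤ Y → 1 ≤ Q₁ → Q₁ ≤ X → 2 ≤ T → T ^ 3 = V → T ≤ X → T ^ 2 ≤ 56 * X →
        W = X ^ (τ / 2) → X * W ≤ T ^ 3 → T ^ 2 * W ≤ X → Y ^ 10 * Q₁ ≤ T ^ 2 → c₅ * X * Y ^ 3 ≤ T ^ 3 →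
        Y ≤ X → Q₁ ^ (1 / 3 : ℝ) * Real.exp (-(c₁ * Real.sqrt (Real.log (hbL X τ)))) ≤ 1 →
        2 ≤ T / ((1248 * (⌊Y⌋₊ + 1) ^ 2 : ℕ) : ℝ) →
        3 * (((1248 * (⌊Y⌋₊ + 1) ^ 2 : ℕ)) : ℝ) + 2 ≤ (T / ((1248 * (⌊Y⌋₊ + 1) ^ 2 : ℕ) : ℝ)) ^ 2 →
        hbL X τ ^ 2 ≤ T / ((1248 * (⌊Y⌋₊ + 1) ^ 2 : ℕ) : ℝ) → X ≤ 270 * V →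
        270 * V / X ≤ κ * (T / ((1248 * (⌊Y⌋₊ + 1) ^ 2 : ℕ) : ℝ)) →
        1 ≤ V / (X * Y) → V / (X * Y) ≤ T → 1 ≤ T ^ 3 * Y ^ 7 / X →
        |bilin (classPairs X η d a₀ b₀) pairIdeal cR (gCut X τ m V)| ≤
          Kc * X ^ 2 * (Y ^ (-(1 / 2 : ℝ)) + Y ^ 30 * X ^ (-(τ / 4)) + Y ^ 8 * Q₁ ^ (-(1 / 8 : ℝ)) +
            Y ^ 8 * Q₁ ^ 2 * Real.exp (-(c₁ / 2 * Real.sqrt (Real.log (hbL X τ))))) * Real.log X ^ c₀ := by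
  classical
  obtain ⟨CE, eE, hCE, heE, hErr⟩ := stub_classMainError
  obtain ⟨c₀, hc₀0, H5⟩ := stub_twistedSsum
  refine ⟨c₀ + eE, by positivity, fun κ C₁ c₅ d hκ hc₅ hd => ?_⟩
  obtain ⟨KS, hKS0, HK⟩ := H5 κ C₁ c₅ d hκ hc₅ hd
  have hd0 : (0 : ℝ) < d := Nat.cast_pos.mpr hd
  refine ⟨(d : ℝ) ^ 3 * Real.sqrt (3375 * KS) + CE, by positivity, ?_⟩
  intro X η τ V T Y Q₁ c₁ W nn m cR a₀ b₀ hη0 hη1 hτ hτ1 hm hHyp hcR hX hlogX hY hQ₁ hQ₁X hT2 hTV hTX hT56 hW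
    hXW hTW hYQ hc₅V hYX hQe hs2 hsN hsL hVX hκs hΔ1 hΔT hd₀
  have hX0 : 0 < X := by linarith
  have hT : 0 < T := by linarith
  have hY0 : 0 < Y := by linarith
  have hQ₁0 : 0 < Q₁ := by linarith
  have hV0 : 0 < V := by rw [← hTV]; positivity
  -- the three inputs, instantiated
  have hM1 := stub_classMainCauchy X η τ V T (nn + 1) m cR d a₀ b₀ hX0 hη1 hT hTV hcR hd
  have hE1 := hErr X η τ V T nn m cR d a₀ b₀ hX hη0 hη1 hτ hτ1 hT hm hcR
  have hSvB : ∀ v : ℤ × ℤ × ℤ,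
      ∑ a ∈ (Abox X T).filter IsPrimitiveVec,
          (∑ b ∈ Bbox T, if Wab X η a b then
              (if DvdVec (d : ℤ) (b - v) then (1 : ℝ) else 0) * Fb X τ m V T b else 0) ^ 2 ≤
        KS * (X * V) * (Y⁻¹ + Y ^ 60 * X ^ (-(τ / 2)) + Y ^ 16 * Q₁ ^ (-(1 / 4 : ℝ)) +
          Y ^ 16 * Q₁ ^ 4 * Real.exp (-(c₁ * Real.sqrt (Real.log (hbL X τ))))) * Real.log X ^ c₀ := by
    intro v
    have hw1 : ∀ b : ℤ × ℤ × ℤ, |(if DvdVec (d : ℤ) (b - v) then (1 : ℝ) else 0)| ≤ 1 := by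
      intro b; split_ifs <;> simp
    have hw2 : ∀ b u : ℤ × ℤ × ℤ, DvdVec (d : ℤ) u →
        (if DvdVec (d : ℤ) (b + u - v) then (1 : ℝ) else 0) =
          (if DvdVec (d : ℤ) (b - v) then (1 : ℝ) else 0) := by
      intro b u hu
      rw [show (DvdVec (d : ℤ) (b + u - v)) = (DvdVec (d : ℤ) (b - v)) from propext (dvdVec_add_sub_iff hu)]
    exact HK X η τ V T Y Q₁ c₁ W nn m (fun b => if DvdVec (d : ℤ) (b - v) then (1 : ℝ) else 0) hw1 hw2
      hη0 hη1 hτ hτ1 hm hHyp hX hlogX hY hQ₁ hQ₁X hT2 hTV hTX hT56 hW hXW hTW hYQ hc₅V hYX hQe hs2 hsN hsL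
      hVX hκs hΔ1 hΔT hd₀
  -- the four terms
  obtain ⟨e₁, e₂', e₃', e₄⟩ :=
    four_terms_sq (τ := τ) (c := c₁) (u := Real.sqrt (Real.log (hbL X τ))) hX0 hY0 hQ₁0
  set U : ℝ := Y⁻¹ + Y ^ 60 * X ^ (-(τ / 2)) + Y ^ 16 * Q₁ ^ (-(1 / 4 : ℝ)) +
    Y ^ 16 * Q₁ ^ 4 * Real.exp (-(c₁ * Real.sqrt (Real.log (hbL X τ)))) with hU
  have hUt : U = (Y ^ (-(1 / 2 : ℝ))) ^ 2 + (Y ^ 30 * X ^ (-(τ / 4))) ^ 2 + (Y ^ 8 * Q₁ ^ (-(1 / 8 : ℝ))) ^ 2 +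
      (Y ^ 8 * Q₁ ^ 2 * Real.exp (-(c₁ / 2 * Real.sqrt (Real.log (hbL X τ))))) ^ 2 := by
    rw [hU, e₁, e₂', e₃', e₄]
  have ht₁0 : 0 ≤ Y ^ (-(1 / 2 : ℝ)) := Real.rpow_nonneg hY0.le _
  have ht₂0 : 0 ≤ Y ^ 30 * X ^ (-(τ / 4)) := mul_nonneg (by positivity) (Real.rpow_nonneg hX0.le _)
  have ht₃0 : 0 ≤ Y ^ 8 * Q₁ ^ (-(1 / 8 : ℝ)) := mul_nonneg (by positivity) (Real.rpow_nonneg hQ₁0.le _)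
  have ht₄0 : 0 ≤ Y ^ 8 * Q₁ ^ 2 * Real.exp (-(c₁ / 2 * Real.sqrt (Real.log (hbL X τ)))) := by positivity
  have hU0 : 0 ≤ U := by rw [hUt]; positivity
  set St : ℝ := Y ^ (-(1 / 2 : ℝ)) + Y ^ 30 * X ^ (-(τ / 4)) + Y ^ 8 * Q₁ ^ (-(1 / 8 : ℝ)) +
    Y ^ 8 * Q₁ ^ 2 * Real.exp (-(c₁ / 2 * Real.sqrt (Real.log (hbL X τ)))) with hSt
  have hsqrtU : Real.sqrt U ≤ St := by rw [hUt]; exact sqrt_sum_four_le ht₁0 ht₂0 ht₃0 ht₄0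
  have hSt0 : 0 ≤ St := by positivity
  have ht₂St : X ^ (-(τ / 4)) ≤ St := by
    have h2 : X ^ (-(τ / 4)) ≤ Y ^ 30 * X ^ (-(τ / 4)) :=
      le_mul_of_one_le_left (Real.rpow_nonneg hX0.le _) (one_le_pow₀ hY)
    linarith
  -- logarithms
  set LX := Real.log X with hLX
  have hLX0 : 0 ≤ LX := by linarith
  -- the twisted `S(v)` are uniformly bounded by `B`
  set B : ℝ := KS * (X * V) * U * LX ^ c₀ with hB
  have hB0 : 0 ≤ B :=
    mul_nonneg (mul_nonneg (mul_nonneg hKS0.le (mul_pos hX0 hV0).le) hU0) (Real.rpow_nonneg hLX0 _)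
  -- the residue set has `d³` elements
  have hcard : (#(Finset.Ico (0 : ℤ) d ×ˢ (Finset.Ico (0 : ℤ) d ×ˢ Finset.Ico (0 : ℤ) d)) : ℝ) = (d : ℝ) ^ 3 := by
    rw [card_product, card_product, Int.card_Ico, sub_zero, Int.toNat_natCast]
    push_cast; ring
  have hsum : ∑ v ∈ Finset.Ico (0 : ℤ) d ×ˢ (Finset.Ico (0 : ℤ) d ×ˢ Finset.Ico (0 : ℤ) d),
      Real.sqrt (∑ a ∈ (Abox X T).filter IsPrimitiveVec,
        (∑ b ∈ Bbox T, if Wab X η a b then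
            (if DvdVec (d : ℤ) (b - v) then (1 : ℝ) else 0) * Fb X τ m V T b else 0) ^ 2) ≤
      (d : ℝ) ^ 3 * Real.sqrt B := by
    refine (sum_le_sum fun v _ => Real.sqrt_le_sqrt (hSvB v)).trans ?_
    rw [sum_const, nsmul_eq_mul, hcard]
  -- `#Abox ≤ (15X/T)³`
  have hA : (#(Abox X T) : ℝ) ≤ (15 * X / T) ^ 3 := by
    refine (card_Abox_le hX0.le hT).trans ?_
    have : 14 * X / T + 1 ≤ 15 * X / T := by
      rw [div_add_one hT.ne', div_le_div_iff_of_pos_right hT]; linarith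
    exact pow_le_pow_left₀ (by positivity) this 3
  -- the core computation of p. 68 / p. 83: `(#Abox)^{1/2} B^{1/2} ≤ √(3375 KS) X² St LX^{c₀+eE}`
  have hcore : Real.sqrt (#(Abox X T)) * Real.sqrt B ≤ Real.sqrt (3375 * KS) * X ^ 2 * St * LX ^ (c₀ + eE) := by
    have h1 : Real.sqrt (#(Abox X T)) * Real.sqrt B ≤ Real.sqrt ((15 * X / T) ^ 3) * Real.sqrt B :=
      mul_le_mul_of_nonneg_right (Real.sqrt_le_sqrt hA) (Real.sqrt_nonneg _)
    refine h1.trans ?_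
    rw [← Real.sqrt_mul (by positivity)]
    have e : (15 * X / T) ^ 3 * B = (3375 * KS) * (X ^ 2) ^ 2 * (U * LX ^ c₀) := by
      rw [hB, ← hTV]; field_simp; ring
    rw [e, Real.sqrt_mul (by positivity), Real.sqrt_mul (by positivity), Real.sqrt_sq (by positivity),
      Real.sqrt_mul hU0]
    have hL1 : Real.sqrt (LX ^ c₀) ≤ LX ^ (c₀ + eE) := by
      rw [Real.sqrt_eq_rpow, ← Real.rpow_mul hLX0]
      exact Real.rpow_le_rpow_of_exponent_le hlogX (by linarith)
    have hL0 : 0 ≤ Real.sqrt (LX ^ c₀) := Real.sqrt_nonneg _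
    calc Real.sqrt (3375 * KS) * X ^ 2 * (Real.sqrt U * Real.sqrt (LX ^ c₀))
        ≤ Real.sqrt (3375 * KS) * X ^ 2 * (St * LX ^ (c₀ + eE)) := by gcongr
      _ = _ := by ring
  -- the main term
  have hmain : |∑ xy ∈ (box X η).filter (fun xy => xy.1 ≡ a₀ [MOD d] ∧ xy.2 ≡ b₀ [MOD d]),
      Hprim X τ m V T cR xy| ≤ (d : ℝ) ^ 3 * Real.sqrt (3375 * KS) * X ^ 2 * St * LX ^ (c₀ + eE) := by
    refine hM1.trans ?_
    calc Real.sqrt (#(Abox X T)) *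
          ∑ v ∈ Finset.Ico (0 : ℤ) d ×ˢ (Finset.Ico (0 : ℤ) d ×ˢ Finset.Ico (0 : ℤ) d),
            Real.sqrt (∑ a ∈ (Abox X T).filter IsPrimitiveVec,
              (∑ b ∈ Bbox T, if Wab X η a b then
                  (if DvdVec (d : ℤ) (b - v) then (1 : ℝ) else 0) * Fb X τ m V T b else 0) ^ 2)
        ≤ Real.sqrt (#(Abox X T)) * ((d : ℝ) ^ 3 * Real.sqrt B) :=
          mul_le_mul_of_nonneg_left hsum (Real.sqrt_nonneg _)
      _ = (d : ℝ) ^ 3 * (Real.sqrt (#(Abox X T)) * Real.sqrt B) := by ring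
      _ ≤ (d : ℝ) ^ 3 * (Real.sqrt (3375 * KS) * X ^ 2 * St * LX ^ (c₀ + eE)) :=
          mul_le_mul_of_nonneg_left hcore (by positivity)
      _ = _ := by ring
  -- the error term
  have herr : |bilin (classPairs X η d a₀ b₀) pairIdeal cR (gCut X τ m V) -
      ∑ xy ∈ (box X η).filter (fun xy => xy.1 ≡ a₀ [MOD d] ∧ xy.2 ≡ b₀ [MOD d]), Hprim X τ m V T cR xy| ≤
      CE * X ^ 2 * St * LX ^ (c₀ + eE) := by
    have hXt : (X ^ τ) ^ (-(1 / 2 : ℝ)) ≤ St := by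
      have e : (X ^ τ) ^ (-(1 / 2 : ℝ)) = X ^ (-(τ / 2)) := by rw [← Real.rpow_mul hX0.le]; ring_nf
      rw [e]
      have h1 : X ^ (-(τ / 2)) ≤ X ^ (-(τ / 4)) := Real.rpow_le_rpow_of_exponent_le (by linarith) (by linarith)
      linarith
    have hLe : LX ^ eE ≤ LX ^ (c₀ + eE) := Real.rpow_le_rpow_of_exponent_le hlogX (by linarith)
    have hX0' : 0 ≤ (X ^ τ) ^ (-(1 / 2 : ℝ)) := Real.rpow_nonneg (Real.rpow_nonneg hX0.le _) _
    calc |bilin (classPairs X η d a₀ b₀) pairIdeal cR (gCut X τ m V) -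
          ∑ xy ∈ (box X η).filter (fun xy => xy.1 ≡ a₀ [MOD d] ∧ xy.2 ≡ b₀ [MOD d]), Hprim X τ m V T cR xy|
        ≤ CE * X ^ 2 * (X ^ τ) ^ (-(1 / 2 : ℝ)) * LX ^ eE := hE1
      _ ≤ CE * X ^ 2 * St * LX ^ (c₀ + eE) := by gcongr
  -- `S_V^{cl} = M + E`
  have hsplit : bilin (classPairs X η d a₀ b₀) pairIdeal cR (gCut X τ m V) =
      (∑ xy ∈ (box X η).filter (fun xy => xy.1 ≡ a₀ [MOD d] ∧ xy.2 ≡ b₀ [MOD d]), Hprim X τ m V T cR xy) +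
        (bilin (classPairs X η d a₀ b₀) pairIdeal cR (gCut X τ m V) -
          ∑ xy ∈ (box X η).filter (fun xy => xy.1 ≡ a₀ [MOD d] ∧ xy.2 ≡ b₀ [MOD d]), Hprim X τ m V T cR xy) := by
    ring
  rw [hsplit]
  refine (abs_add_le _ _).trans ?_
  calc |∑ xy ∈ (box X η).filter (fun xy => xy.1 ≡ a₀ [MOD d] ∧ xy.2 ≡ b₀ [MOD d]), Hprim X τ m V T cR xy| +
        |bilin (classPairs X η d a₀ b₀) pairIdeal cR (gCut X τ m V) -
          ∑ xy ∈ (box X η).filter (fun xy => xy.1 ≡ a₀ [MOD d] ∧ xy.2 ≡ b₀ [MOD d]), Hprim X τ m V T cR xy|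
      ≤ (d : ℝ) ^ 3 * Real.sqrt (3375 * KS) * X ^ 2 * St * LX ^ (c₀ + eE) + CE * X ^ 2 * St * LX ^ (c₀ + eE) :=
        add_le_add hmain herr
    _ = ((d : ℝ) ^ 3 * Real.sqrt (3375 * KS) + CE) * X ^ 2 * St * LX ^ (c₀ + eE) := by ring

set_option maxHeartbeats 2000000 in
open scoped Classical in
/-- **The class bound of p. 83**: `S_V^{cl} ≤ C X²(Y^{−1/2} + Y³⁰X^{−τ/4} + Y⁸Q₁^{−1/8} + Y⁸Q₁²e^{−c₂√(log L)})(log X)^c`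
for `X ≥ X₀`, `1 ≤ Y ≤ X^{τ/3}`, under (3.14) up to `d·Q₁` with `c₃ = 3`, `c₄ = 1` — the tree's
`SV_bound_p83` for the class family (`T = V^{1/3}`, `final_param_ineqs`, `eventually_final_params`).
[cite: HeathBrownActa2001, §13 p. 83] -/
theorem class_p83 : ∀ d a₀ b₀ : ℕ, 0 < d → ∀ ϖ : ℝ, 0 < ϖ → ϖ < 1 / 5 →
    ∃ c c₃ c₄ : ℝ, 0 < c₃ ∧ 0 < c₄ ∧ ∀ C₁ c₁ c₅ c₆ : ℝ, 0 < c₁ → 0 < c₅ → 0 < c₆ →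
      ∃ C c₂ X₀ : ℝ, 0 < c₂ ∧ ∀ X η Q₁ Y : ℝ, X₀ ≤ X → Real.exp (-Real.log X ^ (1 / 3 : ℝ)) ≤ η →
        η ≤ 1 → 1 ≤ Q₁ → Q₁ ≤ Real.exp (Real.log X ^ (1 / 3 : ℝ)) → 1 ≤ Y →
          Y ≤ X ^ (hbTau ϖ X / 3) →
          (∀ (k' : ℕ) (m' : Fin k' → ℕ), CoreAdmissible (hbTau ϖ X) m' →
            Hyp314 X (hbTau ϖ X) m' ((d : ℝ) * Q₁) C₁ c₁ c₃ c₄) →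
            ∀ (k : ℕ) (m : Fin k → ℕ), CoreAdmissible (hbTau ϖ X) m →
              ∀ cR : Ideal (𝓞 K) → ℝ, CSupport X (hbTau ϖ X) cR →
                ∀ V : ℝ, c₅ * X ^ (1 + hbTau ϖ X) ≤ V → V ≤ c₆ * X ^ (3 / 2 - hbTau ϖ X) →
                  |bilin (classPairs X η d a₀ b₀) pairIdeal cR
                      (fun S => if V < (Ideal.absNorm S : ℝ) ∧ (Ideal.absNorm S : ℝ) ≤ 2 * V then
                        fWeight X (hbTau ϖ X) m S else 0)| ≤
                    C * X ^ 2 * (Y ^ (-(1 / 2 : ℝ)) + Y ^ 30 * X ^ (-(hbTau ϖ X / 4)) +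
                      Y ^ 8 * Q₁ ^ (-(1 / 8 : ℝ)) +
                      Y ^ 8 * Q₁ ^ 2 * Real.exp (-(c₂ * Real.sqrt (Real.log (hbL X (hbTau ϖ X)))))) *
                      Real.log X ^ c := by
  intro d a₀ b₀ hd ϖ hϖ0 _hϖ5
  obtain ⟨c₀, -, H⟩ := classSV_le_of_params
  refine ⟨c₀, 3, 1, by norm_num, by norm_num, fun C₁ c₁ c₅ c₆ hc₁ hc₅ hc₆ => ?_⟩
  have hκ0 : (0 : ℝ) < 270 * 4992 * (c₆ ^ (1 / 3 : ℝ)) ^ 2 + 1 := by positivity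
  obtain ⟨Kc, hKc, HK⟩ := H _ C₁ c₅ d hκ0 hc₅ hd
  obtain ⟨X₀, hX₀⟩ := Filter.eventually_atTop.mp
    (eventually_final_params hϖ0 ((c₆ ^ (1 / 3 : ℝ)) ^ 2 + 1 / c₅ + 1 / (270 * c₅) + 1)
      (2 / c₅ ^ (1 / 3 : ℝ) + c₆ ^ (1 / 3 : ℝ) + 2 * 4992 / c₅ ^ (1 / 3 : ℝ) +
        24960 * 4992 ^ 2 / (c₅ ^ (1 / 3 : ℝ)) ^ 2 + 4992 / c₅ ^ (1 / 3 : ℝ) + 1) hc₁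
      (Real.rpow_pos_of_pos hc₅ (2 / 3 : ℝ)))
  refine ⟨Kc, c₁ / 2, X₀, by positivity, ?_⟩
  intro X η Q₁ Y hXX₀ hη1 hη2 hQ₁ hQ₁2 hY1 hY2 hHyp k m hm cR hcR V hV1 hV2
  obtain ⟨hX2, hL1, hτ0, hτ8, hP, hR, hE7, hC8⟩ := hX₀ X hXX₀
  -- no admissible `𝐦` with `k = 0`
  cases k with
  | zero => exact (not_coreAdmissible_zero hτ0 m hm).elim
  | succ n =>
  obtain ⟨hQ₁X, hT2, hTV, hTX, hT56, hXW, hT2W, hYQ, hc₅V, hYX, hQe, hs2, hsN, hsL, hVX, hκs, hΔ1, hΔT, hd₀⟩ :=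
    final_param_ineqs (c₁ := c₁) hX2 hL1 hτ0 hτ8 hc₅ hc₆ hP hR hE7 hC8 hV1 hV2 hY1 hY2 hQ₁ hQ₁2
  have hη0 : 0 ≤ η := le_trans (Real.exp_pos _).le hη1
  have hτ1 : hbTau ϖ X ≤ 1 := by linarith
  -- apply the core bound
  have hmain := HK X η (hbTau ϖ X) V (V ^ (1 / 3 : ℝ)) Y Q₁ c₁ (X ^ (hbTau ϖ X / 2)) n m cR a₀ b₀ hη0 hη2 hτ0
    hτ1 hm (hHyp _ m hm) hcR hX2 hL1 hY1 hQ₁ hQ₁X hT2 hTV hTX hT56 rfl hXW hT2W hYQ hc₅V hYX hQe hs2 hsN hsL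
    hVX hκs hΔ1 hΔT hd₀
  have hg : (fun S : Ideal (𝓞 K) => if V < (Ideal.absNorm S : ℝ) ∧ (Ideal.absNorm S : ℝ) ≤ 2 * V then
      fWeight X (hbTau ϖ X) m S else 0) = gCut X (hbTau ϖ X) m V := by
    funext S; unfold gCut; congr 1
  rw [hg]
  exact hmain


end Summit.Parity.GeneralizedHardyLittlewood.Theorems.GoldbachHeathBrownDispersionHeathBrownMorozUniform

end
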